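import Summits.CriticalPhenomena.SAWScalingLimit.Theses.SAWReversalUpgrade
import Summits.CriticalPhenomena.SAWScalingLimit.Theorems.SAWReversalUpgradePathUpgradeRReturnsDie
import Summits.CriticalPhenomena.SAWScalingLimit.Theorems.SAWReversalUpgradePathUpgradeRUpgradeOfReturns
import Summits.CriticalPhenomena.SAWScalingLimit.Theorems.SAWReversalUpgradePathUpgradeRRangeBound
import Literature.Probability.RandomPlanarGeometry.SeparatedTraces
import HarnessLib

/-!
# Crux `PathUpgradeR` PROVED (stmt-CriticalPhenomena-18055, route `SAWReversalUpgrade`, line `bidir_windows`)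

The closing theorem of the line `bidir_windows` (skeleton `Cruxes/PathUpgradeR/Lines/bidir_windows.lean`):
`Summit.CriticalPhenomena.SAWScalingLimit.Theses.SAWReversalUpgrade.PathUpgradeR`, i.e. for SIMPLE random
curves from `a` to `b` in a Dobrushin domain `(D; a, b)` whose forward and backward driving functions converge
in law on every `[0, T]` to `√(8/3) B` and which do not return to `a` / escape from `b`, the curve classes
converge in law to chordal SLE_(8/3) in `(D; a, b)` (`ConvergesInLawToSLE`).

Glue (no content of its own): `stub_rangeBound` (RANGE: an SLE_(8/3) curve `Γ` of `D` with the closed-set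
bound for the ranges in `NonemptyCompacts ℂ`, from `stub_lawClosed`, `stub_sleHullPackage ∘ stub_hullHausdorff`,
`stub_latticeDictionary`, all landed) turned into the range `TendstoLaw` by `stub_lawClosed (←)` on
`NonemptyCompacts ℂ` (Borel σ-algebra, `1`-Lipschitz range map); `stub_returnsDie` (ORDER: returns die in law,
the lead's stub, `…PathUpgradeRReturnsDie.lean`); the eventual endpoints from H3; `stub_upgradeOfReturns`
(the tree's proved soft curve upgrade `curveUpgrade`) concludes. [folklore]
-/

noncomputable section

open scoped ENNReal NNReal Topology unitInterval
open MeasureTheory Filter Set Metric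
open Literature.Probability Literature.Probability.RandomPlanarGeometry

namespace Summit.CriticalPhenomena.SAWScalingLimit.Theorems

/-- **`PathUpgradeR`** (crux of route `SAWReversalUpgrade`, stmt-CriticalPhenomena-18055): RANGE
(`stub_rangeBound` + `stub_lawClosed (←)`) and ORDER (`stub_returnsDie`) upgrade driving-function convergence
in both directions to convergence in law of the curves to SLE_(8/3), via `stub_upgradeOfReturns`. See the
module docstring. [folklore] -/
theorem PathUpgradeR_proof :
    Summit.CriticalPhenomena.SAWScalingLimit.Theses.SAWReversalUpgrade.PathUpgradeR := by
  intro D φ hφ φ' hφ' Ω _ X P hP hmeas hsimple hfwd hbwd hH6 hH7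
  obtain ⟨Γ, hΓ, hbound⟩ := stub_rangeBound D φ hφ Ω X P hP hmeas hsimple hfwd hH7
  -- the range law from the closed-set bound
  letI : MeasurableSpace (TopologicalSpace.NonemptyCompacts ℂ) := borel _
  haveI : BorelSpace (TopologicalSpace.NonemptyCompacts ℂ) := ⟨rfl⟩
  haveI : IsProbabilityMeasure Process.preWienerMeasure := isProbabilityMeasure_preWienerMeasure'
  set R : CurveClass ℂ → TopologicalSpace.NonemptyCompacts ℂ :=
    fun γ ↦ ⟨⟨γ.range, γ.isCompact_range⟩, γ.range_nonempty⟩ with hR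
  have hRc : Continuous R := by
    refine (LipschitzWith.mk_one fun c c' ↦ ?_).continuous
    rw [Metric.NonemptyCompacts.dist_eq]
    exact CurveClass.hausdorffDist_range_le_dist c c'
  have hmeasR : ∀ᶠ δ in 𝓝[>] (0:ℝ), AEMeasurable (fun ω => R (CurveClass.mk (X δ ω))) (P δ) := by
    filter_upwards [hmeas] with δ hδ
    exact hRc.measurable.comp_aemeasurable hδ
  have hmeasΓ : AEMeasurable (fun ω => R (Γ ω)) Process.preWienerMeasure :=
    hRc.measurable.comp_aemeasurable hΓ.aemeasurable
  have hrange : TendstoLaw (fun δ (ω : Ω δ) => R (CurveClass.mk (X δ ω))) P (fun ω => R (Γ ω))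
      Process.preWienerMeasure :=
    (stub_lawClosed (TopologicalSpace.NonemptyCompacts ℂ) Ω (ℝ≥0 → ℝ)
      (fun δ (ω : Ω δ) => R (CurveClass.mk (X δ ω))) P (fun ω => R (Γ ω)) Process.preWienerMeasure
      inferInstance hP hmeasR hmeasΓ).2 hbound
  -- returns die in law (the lead's stub), endpoints from H3, and the soft upgrade
  have hret := stub_returnsDie D φ hφ φ' hφ' Ω X P hP hmeas hsimple hfwd hbwd hH6 hH7
  have hend : ∀ᶠ δ in 𝓝[>] (0:ℝ), ∀ ω : Ω δ, (X δ ω).source = D.pt 0 ∧ (X δ ω).target = D.pt 1 :=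
    hsimple.mono fun δ h ω => ⟨(h ω).2.1, (h ω).2.2.1⟩
  exact stub_upgradeOfReturns D Ω X P Γ hΓ hmeas hrange hend hret

end Summit.CriticalPhenomena.SAWScalingLimit.Theorems

end
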